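import Literature.Barriers.CriticalPhenomena.WeaklySAWTauDelta
import Literature.Barriers.CriticalPhenomena.WeaklySAWFiniteVolumeRenormalised
import Mathlib.MeasureTheory.Measure.Haar.NormedSpace
import HarnessLib

/-!
# BBS 2015, §3.4 and §4.1: the Gaussian super-expectation `E_C` and the renormalised parameters —
# `G_N(g,ν) = (1+z₀) Ĝ_N(m², g₀, ν₀, z₀)`, `χ_N(g,ν) = (1+z₀) χ̂_N(m², g₀, ν₀, z₀)`

Sequel to `WeaklySAWTauDelta.lean` (Proposition 3.1 of Bauerschmidt–Brydges–Slade, CMP 337 (2015),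
arXiv:1403.7422, for all real `ν`: `G_{N,ν}(0,b) = ∫ e^{-Σ_x(τ_{Δ,x}+gτ_x²+ντ_x)} φ̄_0φ_b`, and
`χ_N = Σ_b G_{N,ν}(0,b)` as a sum of super-integrals). This file formalises the next two steps of the
source on the way to Theorem 4.1.

**§3.4, Definition 3.2** (the Gaussian super-expectation). `superExpectation C F = E_C F := ∫ e^{-S_A} F`,
`A = C⁻¹`, `S_A = φAφ̄ + ψAψ̄` (`superGauss` of `WeaklySAWSuperGaussian.lean`). The displayed properties
are proved for every `A` with positive Hermitian part (`superExpectation_inv_one`: `E_C 1 = 1`, "there is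
no normalisation constant"; `superExpectation_inv_phiBar_phi`: `E_C φ̄_aφ_b = C_{ab}`;
`superExpectation_inv_psiBar_psi` / `superExpectation_inv_psi_psiBar`: `E_C ψ̄_aψ_b = -E_C ψ_bψ̄_a = C_{ab}`).

**§4.1, (4.2)–(4.9)** (approximation by simple random walk). With `V_{g,ν,z;x} = gτ_x² + ντ_x + zτ_{Δ,x}`,
`m² > 0`, `z₀ > -1`, `g₀ = g(1+z₀)²`, `ν₀ = (1+z₀)ν - m²` (equivalently (4.4): `g = g₀/(1+z₀)²`,
`ν = (ν₀+m²)/(1+z₀)`), `V₀(Λ) = Σ_x(g₀τ_x² + ν₀τ_x + z₀τ_{Δ,x})` and `C = (-Δ+m²)⁻¹`, the source rescales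
`(φ,ψ) ↦ (1+z₀)^{1/2}(φ,ψ)` in the super-integral ("there is no explicit Jacobian factor, since we also
make the change of variables in the differentials") to get (ExF) `∫ F e^{-Σ(τ_Δ+gτ²+ντ)} = E_C F' e^{-V₀(Λ)}`
and hence (4.6)–(4.7) `G_N(g,ν) = (1+z₀)Ĝ_N(m²,g₀,ν₀,z₀)`, `Ĝ_N = E_C(e^{-V₀(Λ)}φ̄_aφ_b)`, and (4.8)–(4.9)
`χ̂_N = Σ_x E_C(e^{-V₀(Λ)}φ̄_0φ_x)`, `χ_N(g,ν) = (1+z₀)χ̂_N`. Here: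

* `massLaplacianC d n m² = -Δ_Λ + m²`, `freeCovariance d n m² = C = (-Δ_Λ+m²)⁻¹` (positive Hermitian
  part `m²`, `re_quadForm_massLaplacianC_ge`; `freeCovariance_inv`), and the eigenvalue relation (4.26)
  `C1 = m⁻²1` (`freeCovariance_mulVec_one`, from `(-Δ_Λ)1 = 0`);
* `vZeroForm g₀ ν₀ z₀ = V₀(Λ)` transcribed as a form ((4.5), with `tau`, `tauDelta`), its decomposition
  `vZeroForm_eq : V₀(Λ) = v₀ - N₀` into the degree-zero part
  `v₀(φ) = Σ_x(g₀|φ_x|⁴+ν₀|φ_x|²) + z₀φ(-Δ)φ̄` and the nilpotent even part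
  `N₀ = Σ_x(2g₀|φ_x|²+ν₀)ψ̄_xψ_x - z₀ψ(-Δ)ψ̄` (`vZeroNil_eq_quadratic`, `isNilpotent_vZeroNil`), and
  **`boltzmannZ0 g₀ ν₀ z₀ = Z₀ = e^{-V₀(Λ)}`**, realised as the product of the commuting even forms
  `e^{-z₀Σ_xτ_{Δ,x}} = superGauss (z₀(-Δ))` (eq. (3.11), `sum_tauDelta`) and
  `e^{-Σ(g₀τ²+ν₀τ)} = interactionForm g₀ ν₀`; `boltzmannZ0_eq_exp` shows this IS `e^{-v₀}·exp(N₀)`, the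
  exponential of the even form `-V₀(Λ)` in the sense of the source's (3.4)–(3.5);
* `GhatN d n m² g₀ ν₀ z₀ a b = Ĝ_N = E_C(Z₀ φ̄_aφ_b)` (4.7) and `chiHatNForm d n m² g₀ ν₀ z₀ = Σ_x Ĝ_N(0,x)`
  (4.8);
* **`torusTwoPoint_eq_GhatN`** (4.6): for `m² > 0`, `g₀ > 0`, `ν₀ ∈ ℝ`, `z₀ > -1` and every `b`,
  `G_{N}(g₀/(1+z₀)², (ν₀+m²)/(1+z₀); 0, b) = (1+z₀) Ĝ_N(m², g₀, ν₀, z₀; 0, b)`;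
  **`torusSusceptibility_eq_chiHatNForm`** (4.9): `χ_N(g,ν) = (1+z₀) χ̂_N(m²,g₀,ν₀,z₀)`; and
  `chiHatN_eq_chiHatNForm`: the reparametrised `χ̂_N` of `WeaklySAWFiniteVolumeRenormalised.lean`
  (defined there through (4.9)) equals the super-expectation (4.8);
* the remark closing §3.4, `torusTwoPoint_eq_superExpectation`: for every `ε > 0`,
  `∫e^{-Σ(τ_Δ+gτ²+ντ)}φ̄_0φ_b = E_C(e^{-Σ(gτ²+(ν-ε)τ)}φ̄_0φ_b)` with `C = (-Δ+ε)⁻¹`.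

## The road taken for (4.6) (deviation from the printed proof, documented)

The source obtains (ExF) for a general form `F` by the supersymmetric rescaling of all fields. For the
two-point observable `F = φ̄_aφ_b` — the only instance used in the sequel ((4.6)–(4.9)) — the same
identity follows from what is already in the tree without constructing the rescaling endomorphism of the
form algebra: after the algebra `e^{-S_{-Δ+m²}}·e^{-z₀S_{-Δ}}·e^{-Σ(g₀τ²+ν₀τ)} =
e^{-S_{(1+z₀)(-Δ)}}·e^{-Σ(g₀τ²+(ν₀+m²)τ)}` (`superGauss_mul_superGauss`,
`superGauss_add_diagonal_mul_interactionForm`), both sides are values of the entire function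
`ν ↦ formSideC A g ν a b = ∫e^{-S_A}e^{-Σ(gτ²+ντ)}φ̄_aφ_b` (`WeaklySAWSupersymmetricRepresentationAnalytic`),
and **`formSideC_scale`**: `formSideC A g ν a b = s · formSideC (sA) (s²g) (sν) a b` for every `s > 0`
and `Re φAφ̄ ≥ 0` — for real `ν > 0` by the Gauss–Fourier representation
`∫e^{-S_A}e^{-Σ(gτ²+ντ)}φ̄_aφ_b = ∫Π_xρ_g(w_x)((A+ν+iW)⁻¹)_{ab}dw` of `WeaklySAWTauIsomorphism.lean` and
the substitution `w ↦ sw` (`ρ_{s²g}(sw) = s⁻¹ρ_g(w)`, `(sA+sν+isW)⁻¹ = s⁻¹(A+ν+iW)⁻¹`;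
`integral_resolvent_scale`), then for all `ν ∈ ℂ` by the identity theorem. With `s = 1+z₀` this is
exactly the scaling content of (ExF) for `F = φ̄_aφ_b` (whose `F' = (1+z₀)φ̄_aφ_b` produces the prefactor).

Everything is proved; no named facts.
-/

noncomputable section

open MeasureTheory Filter Topology Set Complex ComplexConjugate
open scoped ENNReal
open Literature.Probability.LatticeModels
open Literature.MathematicalPhysics.QuantumLattice
open Literature.MathematicalPhysics.QuantumLattice.GrassmannAlgebra (berezin)
open scoped BigOperators

namespace Literature.Barriers.CriticalPhenomena

namespace CTWSAW

/-! ### Algebra of the super-Gaussian and the interaction form -/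

section FormAlgebra

variable {Λ : Type*} [Fintype Λ] [LinearOrder Λ]

omit [Fintype Λ] [LinearOrder Λ] in
/-- `ofFun 1 = 1`. [folklore] -/
theorem ofFun_one : (ofFun 1 : SForm Λ) = 1 := by
  unfold ofFun; exact map_one _

omit [Fintype Λ] [LinearOrder Λ] in
/-- The exponential of a central nilpotent form is central. [folklore] -/
theorem commute_grassmannExp {a : SForm Λ} (ha : IsNilpotent a) (h : ∀ z, Commute a z) (z : SForm Λ) :
    Commute (grassmannExp a) z := by
  obtain ⟨k, hk⟩ := ha
  rw [grassmannExp, IsNilpotent.exp_eq_sum hk]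
  exact Commute.sum_left _ _ _ fun i _ => ((h z).pow_left i).smul_left _

/-- **`e^{-S_B}` is central** (an even form). [cite: BauerschmidtBrydgesSlade2015LogCorr, §3.1 ("the even forms … commute")] -/
theorem commute_superGauss (B : Matrix Λ Λ ℂ) (K : SForm Λ) : Commute (superGauss B) K := by
  rw [superGauss_eq]
  refine Commute.mul_left ?_ (commute_grassmannExp (isNilpotent_quadratic _ _) (commute_quadratic _ _) K)
  unfold ofFun; exact Algebra.commute_algebraMap_left _ _

/-- `e^{-S_0} = 1`. [folklore] -/
theorem superGauss_zero : superGauss (0 : Matrix Λ Λ ℂ) = 1 := by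
  rw [superGauss_eq, Matrix.transpose_zero]
  have h1 : constMat (0 : Matrix Λ Λ ℂ) = 0 := map_zero _
  rw [h1, quadratic_zero, grassmannExp, IsNilpotent.exp_zero, mul_one]
  have h2 : (fun φ : Λ → ℂ => Boson.gaussWeight 0 φ) = 1 := by
    funext φ; simp [Boson.gaussWeight, Boson.quadForm]
  rw [h2, ofFun_one]

/-- **`e^{-S_A} e^{-S_B} = e^{-S_{A+B}}`** (the bosonic weights multiply, the commuting fermionic
exponentials merge). [folklore] -/
theorem superGauss_mul_superGauss (A B : Matrix Λ Λ ℂ) : superGauss A * superGauss B = superGauss (A + B) := by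
  rw [superGauss_eq, superGauss_eq, superGauss_eq, Matrix.transpose_add, constMat_add, grassmannExp_quadratic_add]
  set EA := grassmannExp (quadratic (FieldFun Λ) (constMat A.transpose))
  set EB := grassmannExp (quadratic (FieldFun Λ) (constMat B.transpose))
  have hw : (fun φ => Boson.gaussWeight (A + B) φ) =
      (fun φ => Boson.gaussWeight A φ) * fun φ => Boson.gaussWeight B φ := by
    funext φ; simp only [Pi.mul_apply, Boson.gaussWeight, quadForm_add, neg_add, Complex.exp_add]
  rw [hw, ← ofFun_mul_ofFun]
  rw [mul_assoc, ← mul_assoc EA, (ofFun_comm _ EA).symm, mul_assoc, ← mul_assoc]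

/-- **The mass term moves freely between the Gaussian and the interaction**:
`e^{-S_{A+m}} e^{-Σ(gτ²+ντ)} = e^{-S_A} e^{-Σ(gτ²+(ν+m)τ)}` (both are `e^{-S_A - Σ(gτ² + (ν+m)τ)}`; this is
the bookkeeping `V_{0,m²,1} + V_{g₀,ν₀,z₀} = V_{g₀,ν₀+m²,1+z₀}` of (4.2)–(4.3)).
[cite: BauerschmidtBrydgesSlade2015LogCorr, §4.1, eqs. (4.2)–(4.3)] -/
theorem superGauss_add_diagonal_mul_interactionForm (A : Matrix Λ Λ ℂ) (g ν m : ℝ) :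
    superGauss (A + Matrix.diagonal fun _ => (m : ℂ)) * interactionForm g ν =
      superGauss A * interactionForm g (ν + m) := by
  rw [superGauss_mul_interactionForm, superGauss_mul_interactionForm, Matrix.transpose_add,
    Matrix.diagonal_transpose, constMat_add, constMat_diagonal, add_assoc, Matrix.diagonal_add]
  have hb : (fun x => (constFun (m : ℂ) : FieldFun Λ) + interactionCoeff g ν x) = interactionCoeff g (ν + m) := by
    funext x φ
    simp only [Pi.add_apply, interactionCoeff, constFun]
    push_cast; ring
  have ha : ∀ φ : Λ → ℂ, ∀ x, interactionScalar g (ν + m) x φ =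
      interactionScalar g ν x φ + (m : ℂ) * (((‖φ x‖ ^ 2 : ℝ)) : ℂ) := by
    intro φ x; simp only [interactionScalar]; push_cast; ring
  have hw : (fun φ => Boson.gaussWeight (A + Matrix.diagonal fun _ => (m : ℂ)) φ *
      cexp (-∑ x, interactionScalar g ν x φ)) =
      fun φ => Boson.gaussWeight A φ * cexp (-∑ x, interactionScalar g (ν + m) x φ) := by
    funext φ
    rw [Boson.gaussWeight, Boson.gaussWeight, quadForm_add, quadForm_diagonal, ← Complex.exp_add,
      ← Complex.exp_add]
    congr 1
    simp only [ha, Finset.sum_add_distrib]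
    ring
  rw [hb, hw]

/-- `ψ(cB)ψ̄ = c·ψBψ̄` (the constant `c` as a `0`-form). [folklore] -/
theorem fermionAction_smul (c : ℂ) (B : Matrix Λ Λ ℂ) :
    fermionAction (c • B) = ofFun (constFun c) * fermionAction B := by
  unfold fermionAction
  rw [Finset.mul_sum]
  refine Finset.sum_congr rfl fun x _ => ?_
  rw [Finset.mul_sum]
  refine Finset.sum_congr rfl fun y _ => ?_
  rw [ofFun_mul, smul_smul]
  congr 1

omit [LinearOrder Λ] in
/-- `φ(cB)φ̄ = c·φBφ̄`. [folklore] -/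
theorem quadForm_smul (c : ℂ) (B : Matrix Λ Λ ℂ) (φ : Λ → ℂ) :
    Boson.quadForm (c • B) φ = c * Boson.quadForm B φ := by
  have h := quadForm_add_smul 0 B c φ
  have h0 : Boson.quadForm (0 : Matrix Λ Λ ℂ) φ = 0 := by simp [Boson.quadForm]
  rwa [zero_add, h0, zero_add] at h

omit [LinearOrder Λ] in
/-- `Re φ(sA)φ̄ ≥ 0` for `s ≥ 0` when `Re φAφ̄ ≥ 0`. [folklore] -/
theorem re_quadForm_smul_nonneg {A : Matrix Λ Λ ℂ} (hA : ∀ φ, 0 ≤ (Boson.quadForm A φ).re) {s : ℝ}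
    (hs : 0 ≤ s) (φ : Λ → ℂ) : 0 ≤ (Boson.quadForm ((s : ℂ) • A) φ).re := by
  rw [quadForm_smul, Complex.re_ofReal_mul]
  exact mul_nonneg hs (hA φ)

/-- `∫(-K) = -∫K`. [folklore] -/
theorem superIntegral_neg (K : SForm Λ) : superIntegral (-K) = -superIntegral K := by
  simp only [superIntegral, map_neg, Pi.neg_apply, integral_neg]
  ring

end FormAlgebra

/-! ### The Gaussian super-expectation `E_C` (Definition 3.2) -/

section SuperExpectation

variable {Λ : Type*} [Fintype Λ] [LinearOrder Λ]

/-- **The Gaussian super-expectation with covariance `C`** (BBS 2015, Definition 3.2): for a form `F`,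
`E_C F := ∫ e^{-S_A(Λ)} F` with `A = C⁻¹` and `S_A(Λ) = Σ_{x,y}(φ_xA_{xy}φ̄_y + ψ_xA_{xy}ψ̄_y)` — the
super-integral (`superIntegral`) of `superGauss C⁻¹ · F`. (In the source `C` is positive-definite; the
definition makes sense for every `C`, the theorems below carry the positivity hypotheses.)
[cite: BauerschmidtBrydgesSlade2015LogCorr, Definition 3.2 and eq. (3.13) (S_A(Λ))] -/
def superExpectation (C : Matrix Λ Λ ℂ) (F : SForm Λ) : ℂ := superIntegral (superGauss C⁻¹ * F)

variable {A : Matrix Λ Λ ℂ} {c : ℝ}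

/-- `E_{A⁻¹} F = ∫ e^{-S_A} F` for invertible `A`. [folklore] -/
theorem superExpectation_inv_eq (hA : IsUnit A.det) (F : SForm Λ) :
    superExpectation A⁻¹ F = superIntegral (superGauss A * F) := by
  rw [superExpectation, Matrix.nonsing_inv_nonsing_inv A hA]

/-- A matrix with positive Hermitian part has invertible determinant. [folklore] -/
theorem isUnit_det_of_re_quadForm_ge (hc : 0 < c) (hA : ∀ φ, c * ∑ x, ‖φ x‖ ^ 2 ≤ (Boson.quadForm A φ).re) :
    IsUnit A.det :=
  (Matrix.isUnit_iff_isUnit_det A).1 (Boson.isUnit_of_re_quadForm_ge hc hA)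

/-- **`E_C 1 = 1`**: "as a result of supersymmetry … there is no normalisation constant" (for
`C = A⁻¹`, `A` with positive Hermitian part). [cite: BauerschmidtBrydgesSlade2015LogCorr, §3.4 (display E_C F = ∫e^{-S_A}F and "there is no normalisation constant in (3.15)")] -/
theorem superExpectation_inv_one (hc : 0 < c) (hA : ∀ φ, c * ∑ x, ‖φ x‖ ^ 2 ≤ (Boson.quadForm A φ).re) :
    superExpectation A⁻¹ 1 = 1 := by
  rw [superExpectation_inv_eq (isUnit_det_of_re_quadForm_ge hc hA), mul_one]
  exact superIntegral_superGauss hc hA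

/-- **`E_C φ̄_aφ_b = C_{ab}`**: "`C` is the covariance of the Gaussian measure" (`C = A⁻¹`).
[cite: BauerschmidtBrydgesSlade2015LogCorr, §3.4 (display "E_C φ̄_a φ_b = C_{ab}")] -/
theorem superExpectation_inv_phiBar_phi (hc : 0 < c)
    (hA : ∀ φ, c * ∑ x, ‖φ x‖ ^ 2 ≤ (Boson.quadForm A φ).re) (a b : Λ) :
    superExpectation A⁻¹ (ofFun fun φ => conj (φ a) * φ b) = A⁻¹ a b := by
  rw [superExpectation_inv_eq (isUnit_det_of_re_quadForm_ge hc hA), (commute_superGauss A _).eq,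
    show (fun φ : Λ → ℂ => conj (φ a) * φ b) = fun φ => φ b * conj (φ a) from funext fun _ => mul_comm _ _]
  exact superIntegral_ofFun_mul_superGauss hc hA b a

/-- **`E_C ψ_bψ̄_a = -C_{ab}`** (`C = A⁻¹`). [cite: BauerschmidtBrydgesSlade2015LogCorr, §3.4 (display "E_C ψ̄_aψ_b = -E_C ψ_bψ̄_a = C_{ab}")] -/
theorem superExpectation_inv_psi_psiBar (hc : 0 < c)
    (hA : ∀ φ, c * ∑ x, ‖φ x‖ ^ 2 ≤ (Boson.quadForm A φ).re) (a b : Λ) :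
    superExpectation A⁻¹ (psi (FieldFun Λ) b * psiBar (FieldFun Λ) a) = -A⁻¹ a b := by
  rw [superExpectation_inv_eq (isUnit_det_of_re_quadForm_ge hc hA), (commute_superGauss A _).eq]
  exact superIntegral_psi_mul_psiBar_mul_superGauss hc hA b a

/-- **`E_C ψ̄_aψ_b = C_{ab}`**: "`C` is also the covariance of `ψ`" (`C = A⁻¹`).
[cite: BauerschmidtBrydgesSlade2015LogCorr, §3.4 (display "E_C ψ̄_aψ_b = -E_C ψ_bψ̄_a = C_{ab}")] -/
theorem superExpectation_inv_psiBar_psi (hc : 0 < c)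
    (hA : ∀ φ, c * ∑ x, ‖φ x‖ ^ 2 ≤ (Boson.quadForm A φ).re) (a b : Λ) :
    superExpectation A⁻¹ (psiBar (FieldFun Λ) a * psi (FieldFun Λ) b) = A⁻¹ a b := by
  have h : psiBar (FieldFun Λ) a * psi (FieldFun Λ) b = -(psi (FieldFun Λ) b * psiBar (FieldFun Λ) a) := by
    rw [psi_mul_psiBar, neg_neg]
  rw [h, superExpectation, mul_neg, superIntegral_neg, ← superExpectation,
    superExpectation_inv_psi_psiBar hc hA, neg_neg]

end SuperExpectation

/-! ### Rescaling the Fourier variables: `formSideC A g ν = s · formSideC (sA) (s²g) (sν)` -/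

section Scaling

variable {Λ : Type*} [Fintype Λ] [LinearOrder Λ] {A : Matrix Λ Λ ℂ} {g s : ℝ}

omit [Fintype Λ] [LinearOrder Λ] in
/-- `ρ_{s²g}(w) = s⁻¹ ρ_g(w/s)` (`s > 0`). [folklore] -/
theorem gaussDensity_scale (hg : 0 < g) (hs : 0 < s) (w : ℝ) :
    gaussDensity (s ^ 2 * g) w = s⁻¹ * gaussDensity g (s⁻¹ * w) := by
  have hs0 : s ≠ 0 := hs.ne'
  have hg0 : g ≠ 0 := hg.ne'
  unfold gaussDensity
  have h1 : Real.sqrt (4 * Real.pi * (s ^ 2 * g)) = s * Real.sqrt (4 * Real.pi * g) := by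
    rw [show 4 * Real.pi * (s ^ 2 * g) = s ^ 2 * (4 * Real.pi * g) by ring, Real.sqrt_mul (sq_nonneg s),
      Real.sqrt_sq hs.le]
  have h2 : (s⁻¹ * w) ^ 2 / (4 * g) = w ^ 2 / (4 * (s ^ 2 * g)) := by
    field_simp
  rw [h1, h2, mul_inv, mul_assoc]

/-- Two entire functions which agree on the positive reals agree everywhere (identity theorem; the
positive reals accumulate at `1`). [folklore] -/
theorem entire_eq_of_eqOn_pos {f h : ℂ → ℂ} (hf : AnalyticOnNhd ℂ f univ) (hh : AnalyticOnNhd ℂ h univ)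
    (heq : ∀ t : ℝ, 0 < t → f t = h t) (ν : ℂ) : f ν = h ν := by
  have htend : Tendsto (fun k : ℕ => (((1 + 1 / ((k : ℝ) + 1) : ℝ)) : ℂ)) atTop (𝓝[≠] (1 : ℂ)) := by
    refine tendsto_nhdsWithin_iff.2 ⟨?_, Eventually.of_forall fun k => ?_⟩
    · have h1 : Tendsto (fun k : ℕ => (1 + 1 / ((k : ℝ) + 1) : ℝ)) atTop (𝓝 (1 + 0)) :=
        tendsto_one_div_add_atTop_nhds_zero_nat.const_add 1
      rw [add_zero] at h1
      have h2 := (Complex.continuous_ofReal.tendsto 1).comp h1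
      rwa [Complex.ofReal_one] at h2
    · simp only [mem_compl_iff, mem_singleton_iff]
      intro h
      have h' := congrArg Complex.re h
      simp only [Complex.ofReal_re, Complex.one_re] at h'
      have : 0 < 1 / ((k : ℝ) + 1) := by positivity
      linarith
  have hfreq : ∃ᶠ z in 𝓝[≠] (1 : ℂ), f z = h z :=
    htend.frequently (Frequently.of_forall fun k => heq _ (by positivity))
  exact hf.eqOn_of_preconnected_of_frequently_eq hh isPreconnected_univ (mem_univ _) hfreq (mem_univ ν)

/-- **Rescaling the Fourier variables `w ↦ sw`** in the Gauss–Fourier representation: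
`∫Π_xρ_{s²g}(w_x)((sA + st + iW)⁻¹)_{ab}dw = s⁻¹∫Π_xρ_g(w_x)((A + t + iW)⁻¹)_{ab}dw` (`s, t > 0`,
`Re φAφ̄ ≥ 0`): `ρ_{s²g}(sw) = s⁻¹ρ_g(w)`, `(sA+st+isW)⁻¹ = s⁻¹(A+t+iW)⁻¹`, `d(sw) = s^{|Λ|}dw`. [folklore] -/
theorem integral_resolvent_scale (hA : ∀ φ, 0 ≤ (Boson.quadForm A φ).re) (hg : 0 < g) (hs : 0 < s)
    {t : ℝ} (ht : 0 < t) (a b : Λ) :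
    ∫ w : Λ → ℝ, (∏ x, (gaussDensity (s ^ 2 * g) (w x) : ℂ)) *
        ((s : ℂ) • A + Matrix.diagonal fun x => ((s * t : ℝ) : ℂ) + I * w x)⁻¹ a b =
      (s : ℂ)⁻¹ * ∫ w : Λ → ℝ, (∏ x, (gaussDensity g (w x) : ℂ)) *
        (A + Matrix.diagonal fun x => (t : ℂ) + I * w x)⁻¹ a b := by
  have hs0 : (s : ℂ) ≠ 0 := by exact_mod_cast hs.ne'
  set F : (Λ → ℝ) → ℂ := fun w => (∏ x, (gaussDensity g (w x) : ℂ)) *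
    (A + Matrix.diagonal fun x => (t : ℂ) + I * w x)⁻¹ a b with hF
  have hpt : ∀ w : Λ → ℝ, (∏ x, (gaussDensity (s ^ 2 * g) (w x) : ℂ)) *
      ((s : ℂ) • A + Matrix.diagonal fun x => ((s * t : ℝ) : ℂ) + I * w x)⁻¹ a b =
      ((s : ℂ)⁻¹) ^ Fintype.card Λ * (s : ℂ)⁻¹ * F (s⁻¹ • w) := by
    intro w
    -- the densities
    have hρ : (∏ x, (gaussDensity (s ^ 2 * g) (w x) : ℂ)) =
        ((s : ℂ)⁻¹) ^ Fintype.card Λ * ∏ x, (gaussDensity g ((s⁻¹ • w) x) : ℂ) := by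
      simp_rw [gaussDensity_scale hg hs, Complex.ofReal_mul, Finset.prod_mul_distrib, Finset.prod_const,
        Finset.card_univ, Pi.smul_apply, smul_eq_mul, Complex.ofReal_inv]
    -- the matrices
    have hunit : IsUnit (A + Matrix.diagonal fun x => (t : ℂ) + I * (((s⁻¹ • w) x : ℝ) : ℂ)).det :=
      isUnit_det_of_re_quadForm_ge ht (re_quadForm_add_diagonal_ge hA t (s⁻¹ • w))
    have hmat : ((s : ℂ) • A + Matrix.diagonal fun x => ((s * t : ℝ) : ℂ) + I * w x)⁻¹ =
        (s : ℂ)⁻¹ • (A + Matrix.diagonal fun x => (t : ℂ) + I * (((s⁻¹ • w) x : ℝ) : ℂ))⁻¹ := by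
      have heq : ((s : ℂ) • A + Matrix.diagonal fun x => ((s * t : ℝ) : ℂ) + I * w x) =
          (s : ℂ) • (A + Matrix.diagonal fun x => (t : ℂ) + I * (((s⁻¹ • w) x : ℝ) : ℂ)) := by
        rw [smul_add, ← Matrix.diagonal_smul]
        congr 1
        congr 1
        funext x
        simp only [Pi.smul_apply, smul_eq_mul]
        push_cast
        field_simp
      rw [heq]
      haveI := invertibleOfNonzero hs0
      rw [Matrix.inv_smul _ (s : ℂ) hunit, invOf_eq_inv]
    rw [hρ, hmat, Matrix.smul_apply, smul_eq_mul, hF]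
    ring
  simp_rw [hpt]
  rw [integral_const_mul, Measure.integral_comp_inv_smul_of_nonneg volume F hs.le,
    Module.finrank_fintype_fun_eq_card, Complex.real_smul, Complex.ofReal_pow]
  field_simp
  rw [one_div, inv_pow, inv_mul_cancel₀ (pow_ne_zero _ hs0), one_mul]

/-- **Scaling identity for the form side** (the content of (ExF) for `F = φ̄_aφ_b`): for `Re φAφ̄ ≥ 0`,
`g > 0`, `s > 0` and every complex `ν`,
`∫e^{-S_A}e^{-Σ(gτ²+ντ)}φ̄_aφ_b = s·∫e^{-S_{sA}}e^{-Σ(s²g τ² + sν τ)}φ̄_aφ_b`. Both sides are entire in `ν`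
(`analyticOnNhd_formSideC`); for real `ν > 0` they are the two sides of `integral_resolvent_scale` by the
Gauss–Fourier representation `superIntegral_interaction_eq_integral_resolvent`. In the source this is the
rescaling `(φ,ψ) ↦ s^{1/2}(φ,ψ)` with no Jacobian. [cite: BauerschmidtBrydgesSlade2015LogCorr, §4.1, eq. (ExF) and the display G_N(g,ν) = (1+z₀)Ĝ_N (proof: "by making the change of variables φ_x ↦ (1+z₀)^{1/2}φ_x … there is no explicit Jacobian factor")] -/
theorem formSideC_scale [Nonempty Λ] (hA : ∀ φ, 0 ≤ (Boson.quadForm A φ).re) (hg : 0 < g) (hs : 0 < s)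
    (a b : Λ) (ν : ℂ) :
    formSideC A g ν a b = (s : ℂ) * formSideC ((s : ℂ) • A) (s ^ 2 * g) ((s : ℂ) * ν) a b := by
  have hA' : ∀ φ, 0 ≤ (Boson.quadForm ((s : ℂ) • A) φ).re := re_quadForm_smul_nonneg hA hs.le
  have hg' : 0 < s ^ 2 * g := by positivity
  refine entire_eq_of_eqOn_pos (f := fun ν => formSideC A g ν a b)
    (h := fun ν => (s : ℂ) * formSideC ((s : ℂ) • A) (s ^ 2 * g) ((s : ℂ) * ν) a b)
    (analyticOnNhd_formSideC hA hg a b) ?_ ?_ ν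
  · have hd : Differentiable ℂ fun ν : ℂ => (s : ℂ) * formSideC ((s : ℂ) • A) (s ^ 2 * g) ((s : ℂ) * ν) a b :=
      ((differentiable_formSideC hA' hg' a b).comp ((differentiable_id).const_mul (s : ℂ))).const_mul _
    exact hd.differentiableOn.analyticOnNhd isOpen_univ
  · intro t ht
    have hst : 0 < s * t := mul_pos hs ht
    show formSideC A g (t : ℂ) a b = (s : ℂ) * formSideC ((s : ℂ) • A) (s ^ 2 * g) ((s : ℂ) * (t : ℂ)) a b
    rw [show (s : ℂ) * (t : ℂ) = ((s * t : ℝ) : ℂ) by push_cast; ring, formSideC_ofReal, formSideC_ofReal,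
      superIntegral_interaction_eq_integral_resolvent hA hg ht,
      superIntegral_interaction_eq_integral_resolvent hA' hg' hst, integral_resolvent_scale hA hg hs ht,
      ← mul_assoc, mul_inv_cancel₀ (by exact_mod_cast hs.ne'), one_mul]

end Scaling

/-! ### The torus: `C = (-Δ+m²)⁻¹`, `V₀(Λ)`, `Z₀ = e^{-V₀(Λ)}`, `Ĝ_N`, `χ̂_N` -/

section Torus

variable {d n : ℕ} [NeZero n]

/-- `(-Δ_Λ)1 = 0` (the rows of the Laplacian sum to zero). [folklore] -/
theorem negLaplacianC_mulVec_one : (negLaplacianC d n).mulVec (fun _ => (1 : ℂ)) = 0 := by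
  funext x
  rw [negLaplacianC, schrodingerMatrixC, Matrix.sub_mulVec, Pi.sub_apply, torusStepMatrixC_mulVec,
    Matrix.mulVec_diagonal, Finset.sum_const, Finset.card_univ, SRW.card_dir, nsmul_eq_mul]
  simp only [Pi.zero_apply, add_zero, mul_one]
  push_cast
  ring

-- as in `WeaklySAWTauDelta.lean`: the generators `ψ_x, ψ̄_x` and `Matrix.diagonal` on `Λ = TorusSite d n`
-- must be elaborated with the `DecidableEq` instance underlying `instLinearOrderTorusSite`.
attribute [-instance] Fintype.decidablePiFintype

/-- `-Δ_Λ + m²` (complex entries). [cite: BauerschmidtBrydgesSlade2015LogCorr, §4.1 ("Let C = (-Δ+m²)⁻¹, with Δ the discrete Laplacian on Λ_N")] -/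
def massLaplacianC (d n : ℕ) [NeZero n] (m2 : ℝ) : Matrix (TorusSite d n) (TorusSite d n) ℂ :=
  negLaplacianC d n + Matrix.diagonal fun _ => (m2 : ℂ)

/-- **The free covariance `C = (-Δ_Λ + m²)⁻¹`.** [cite: BauerschmidtBrydgesSlade2015LogCorr, §4.1 ("Let C = (-Δ+m²)⁻¹")] -/
def freeCovariance (d n : ℕ) [NeZero n] (m2 : ℝ) : Matrix (TorusSite d n) (TorusSite d n) ℂ :=
  (massLaplacianC d n m2)⁻¹

/-- `-Δ+m²` has positive Hermitian part `m²`: `Re φ(-Δ+m²)φ̄ ≥ m²Σ|φ_x|²`. [folklore] -/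
theorem re_quadForm_massLaplacianC_ge (m2 : ℝ) (φ : TorusSite d n → ℂ) :
    m2 * ∑ x, ‖φ x‖ ^ 2 ≤ (Boson.quadForm (massLaplacianC d n m2) φ).re := by
  have h := re_quadForm_add_diagonal_ge (A := negLaplacianC d n) re_quadForm_negLaplacianC_nonneg m2 0 φ
  have h0 : (Matrix.diagonal fun x : TorusSite d n => (m2 : ℂ) + I * ((0 : TorusSite d n → ℝ) x : ℝ)) =
      Matrix.diagonal fun _ => (m2 : ℂ) := by
    congr 1; funext x; simp
  rw [h0] at h
  exact h

/-- `det(-Δ+m²)` is a unit for `m² > 0`. [folklore] -/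
theorem isUnit_det_massLaplacianC {m2 : ℝ} (hm : 0 < m2) : IsUnit (massLaplacianC d n m2).det :=
  isUnit_det_of_re_quadForm_ge hm (re_quadForm_massLaplacianC_ge m2)

/-- `C⁻¹ = -Δ+m²` (`m² > 0`). [folklore] -/
theorem freeCovariance_inv {m2 : ℝ} (hm : 0 < m2) : (freeCovariance d n m2)⁻¹ = massLaplacianC d n m2 :=
  Matrix.nonsing_inv_nonsing_inv _ (isUnit_det_massLaplacianC hm)

/-- `(-Δ+m²)1 = m²1`. [folklore] -/
theorem massLaplacianC_mulVec_one (m2 : ℝ) :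
    (massLaplacianC d n m2).mulVec (fun _ => (1 : ℂ)) = fun _ => (m2 : ℂ) := by
  rw [massLaplacianC, Matrix.add_mulVec, negLaplacianC_mulVec_one, zero_add]
  funext x
  rw [Matrix.mulVec_diagonal, mul_one]

/-- **`C1 = (-Δ+m²)⁻¹1 = m⁻²1`**: the constant function is an eigenfunction of the covariance.
[cite: BauerschmidtBrydgesSlade2015LogCorr, §4.1, eq. (4.26) (C1 = (-Δ+m²)⁻¹1 = m⁻²1)] -/
theorem freeCovariance_mulVec_one {m2 : ℝ} (hm : 0 < m2) :
    (freeCovariance d n m2).mulVec (fun _ => (1 : ℂ)) = fun _ => (m2 : ℂ)⁻¹ := by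
  have hm' : (m2 : ℂ) ≠ 0 := by exact_mod_cast hm.ne'
  have h2 : (freeCovariance d n m2).mulVec ((massLaplacianC d n m2).mulVec fun _ => (1 : ℂ)) = fun _ => 1 := by
    rw [Matrix.mulVec_mulVec, freeCovariance, Matrix.nonsing_inv_mul _ (isUnit_det_massLaplacianC hm),
      Matrix.one_mulVec]
  rw [massLaplacianC_mulVec_one] at h2
  have h3 : (fun _ : TorusSite d n => (m2 : ℂ)) = (m2 : ℂ) • fun _ => (1 : ℂ) := by
    funext x; simp
  rw [h3, Matrix.mulVec_smul] at h2
  funext x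
  have hx := congrFun h2 x
  simp only [Pi.smul_apply, smul_eq_mul] at hx
  calc (freeCovariance d n m2).mulVec (fun _ => (1 : ℂ)) x
      = (m2 : ℂ)⁻¹ * ((m2 : ℂ) * (freeCovariance d n m2).mulVec (fun _ => (1 : ℂ)) x) := by
        rw [← mul_assoc, inv_mul_cancel₀ hm', one_mul]
    _ = (m2 : ℂ)⁻¹ := by rw [hx, mul_one]

/-- `E_C F = ∫ e^{-S_{-Δ+m²}} F` for `C = (-Δ+m²)⁻¹`, `m² > 0`. [folklore] -/
theorem superExpectation_freeCovariance {m2 : ℝ} (hm : 0 < m2) (F : SForm (TorusSite d n)) :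
    superExpectation (freeCovariance d n m2) F = superIntegral (superGauss (massLaplacianC d n m2) * F) :=
  superExpectation_inv_eq (isUnit_det_massLaplacianC hm) F

/-- `E_C 1 = 1` for `C = (-Δ+m²)⁻¹`, `m² > 0`. [cite: BauerschmidtBrydgesSlade2015LogCorr, §4.1 ("the partition function E_C Z₀ is equal to 1 by supersymmetry"; case Z₀ = 1)] -/
theorem superExpectation_freeCovariance_one {m2 : ℝ} (hm : 0 < m2) :
    superExpectation (freeCovariance d n m2) 1 = 1 :=
  superExpectation_inv_one hm (re_quadForm_massLaplacianC_ge m2)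

/-- `E_C φ̄_aφ_b = C_{ab}` for `C = (-Δ+m²)⁻¹`, `m² > 0` ("if we set `V₀ = 0` … the simple random walk
two-point function with mass `m²`"). [cite: BauerschmidtBrydgesSlade2015LogCorr, §4.1 ("If we set V₀ = 0 on the right-hand side of (4.7), the result is a multiple of the simple random walk two-point function with mass m²")] -/
theorem superExpectation_freeCovariance_phiBar_phi {m2 : ℝ} (hm : 0 < m2) (a b : TorusSite d n) :
    superExpectation (freeCovariance d n m2) (ofFun fun φ => conj (φ a) * φ b) = freeCovariance d n m2 a b :=
  superExpectation_inv_phiBar_phi hm (re_quadForm_massLaplacianC_ge m2) a b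

/-! #### `V₀(Λ)` and `Z₀ = e^{-V₀(Λ)}` -/

/-- **`V₀(Λ) = Σ_{x∈Λ}(g₀τ_x² + ν₀τ_x + z₀τ_{Δ,x})`** transcribed as a form (the couplings as constant
`0`-forms). [cite: BauerschmidtBrydgesSlade2015LogCorr, §4.1, eqs. (4.2) and (4.5)] -/
def vZeroForm (g₀ ν₀ z₀ : ℝ) : SForm (TorusSite d n) :=
  ∑ x, (ofFun (constFun (g₀ : ℂ)) * (tau x * tau x) + ofFun (constFun (ν₀ : ℂ)) * tau x +
    ofFun (constFun (z₀ : ℂ)) * tauDelta d n x)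

/-- The degree-zero part `v₀(φ) = Σ_x(g₀|φ_x|⁴ + ν₀|φ_x|²) + z₀ φ(-Δ)φ̄` of `V₀(Λ)`. [folklore] -/
def vZeroScalar (g₀ ν₀ z₀ : ℝ) : FieldFun (TorusSite d n) :=
  fun φ => ∑ x, interactionScalar g₀ ν₀ x φ + (z₀ : ℂ) * Boson.quadForm (negLaplacianC d n) φ

/-- The nilpotent part `N₀ = Σ_x(2g₀|φ_x|² + ν₀)ψ̄_xψ_x - z₀ψ(-Δ)ψ̄` of `-V₀(Λ)` (so `V₀(Λ) = v₀ - N₀`).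
[folklore] -/
def vZeroNil (g₀ ν₀ z₀ : ℝ) : SForm (TorusSite d n) :=
  ∑ x, ofFun (interactionCoeff g₀ ν₀ x) * pairBar x - ofFun (constFun (z₀ : ℂ)) * fermionAction (negLaplacianC d n)

/-- **`V₀(Λ) = v₀ - N₀`** in the algebra of forms (`gτ_x²+ντ_x = a_x - b_xψ̄_xψ_x`, `interaction_eq`;
`Σ_xτ_{Δ,x} = φ(-Δ)φ̄ + ψ(-Δ)ψ̄`, eq. (3.11), `sum_tauDelta`). [cite: BauerschmidtBrydgesSlade2015LogCorr, §3.3, eqs. (3.8), (3.11) and §4.1, eq. (4.5)] -/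
theorem vZeroForm_eq (g₀ ν₀ z₀ : ℝ) :
    (vZeroForm g₀ ν₀ z₀ : SForm (TorusSite d n)) = ofFun (vZeroScalar g₀ ν₀ z₀) - vZeroNil g₀ ν₀ z₀ := by
  have hofFun_sum : ∀ f : TorusSite d n → FieldFun (TorusSite d n),
      (∑ x, ofFun (f x) : SForm (TorusSite d n)) = ofFun (∑ x, f x) := fun f => by
    unfold ofFun; exact (map_sum (algebraMap (FieldFun (TorusSite d n)) (SForm (TorusSite d n))) f _).symm
  unfold vZeroForm vZeroNil
  rw [Finset.sum_add_distrib, ← Finset.mul_sum, sum_tauDelta]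
  simp_rw [interaction_eq]
  rw [Finset.sum_sub_distrib, hofFun_sum, mul_add, ofFun_mul_ofFun]
  have hs : (ofFun (vZeroScalar g₀ ν₀ z₀) : SForm (TorusSite d n)) =
      ofFun (∑ x, interactionScalar g₀ ν₀ x) + ofFun (constFun (z₀ : ℂ) * Boson.quadForm (negLaplacianC d n)) := by
    rw [← ofFun_add]
    congr 1
    funext φ
    simp only [vZeroScalar, Pi.add_apply, Finset.sum_apply, Pi.mul_apply, constFun]
  rw [hs]
  abel

/-- `N₀` is the quadratic action of the matrix `(z₀(-Δ))ᵀ` (as constants) `+ diag b` over the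
`0`-forms. [folklore] -/
theorem vZeroNil_eq_quadratic (g₀ ν₀ z₀ : ℝ) :
    (vZeroNil g₀ ν₀ z₀ : SForm (TorusSite d n)) = quadratic (FieldFun (TorusSite d n))
      (constMat ((z₀ : ℂ) • negLaplacianC d n).transpose + Matrix.diagonal (interactionCoeff g₀ ν₀)) := by
  rw [quadratic_add, quadratic_diagonal, ← neg_neg (quadratic _ (constMat _)), ← fermionAction_eq_neg_quadratic,
    fermionAction_smul, vZeroNil]
  simp_rw [ofFun_mul]
  abel

/-- `N₀` is nilpotent. [folklore] -/
theorem isNilpotent_vZeroNil (g₀ ν₀ z₀ : ℝ) : IsNilpotent (vZeroNil g₀ ν₀ z₀ : SForm (TorusSite d n)) := by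
  rw [vZeroNil_eq_quadratic]; exact isNilpotent_quadratic _ _

/-- `N₀` is central. [folklore] -/
theorem commute_vZeroNil (g₀ ν₀ z₀ : ℝ) (K : SForm (TorusSite d n)) : Commute (vZeroNil g₀ ν₀ z₀) K := by
  rw [vZeroNil_eq_quadratic]; exact commute_quadratic _ _ K

/-- **`Z₀ = e^{-V₀(Λ)}`**, `V₀(Λ) = Σ_x(g₀τ_x²+ν₀τ_x+z₀τ_{Δ,x})`: the product of the commuting even forms
`e^{-z₀Σ_xτ_{Δ,x}} = e^{-S_{z₀(-Δ)}}` (eq. (3.11)) and `e^{-Σ_x(g₀τ_x²+ν₀τ_x)}`; by `boltzmannZ0_eq_exp`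
this is `e^{-v₀}·exp(N₀)`, the exponential of the even form `-V₀(Λ) = -v₀ + N₀` defined through its
Taylor series about the degree-zero part ((3.4)–(3.5)).
[cite: BauerschmidtBrydgesSlade2015LogCorr, §4.1, eqs. (4.5), (4.7) and (4.14) (Z₀ = e^{-V₀(Λ)})] -/
def boltzmannZ0 (g₀ ν₀ z₀ : ℝ) : SForm (TorusSite d n) :=
  superGauss ((z₀ : ℂ) • negLaplacianC d n) * interactionForm g₀ ν₀

/-- **`Z₀ = e^{-v₀}·exp(N₀)`** with `V₀(Λ) = v₀ - N₀` (`vZeroForm_eq`), `N₀` nilpotent and central. [cite: BauerschmidtBrydgesSlade2015LogCorr, §3.2, eqs. (3.4)–(3.5) (functions of even forms) and §4.1 (Z₀ = e^{-V₀(Λ)})] -/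
theorem boltzmannZ0_eq_exp (g₀ ν₀ z₀ : ℝ) :
    (boltzmannZ0 g₀ ν₀ z₀ : SForm (TorusSite d n)) =
      ofFun (fun φ => cexp (-vZeroScalar g₀ ν₀ z₀ φ)) * grassmannExp (vZeroNil g₀ ν₀ z₀) := by
  rw [boltzmannZ0, superGauss_mul_interactionForm, vZeroNil_eq_quadratic]
  congr 1
  congr 1
  funext φ
  rw [Boson.gaussWeight, ← Complex.exp_add, quadForm_smul]
  congr 1
  simp only [vZeroScalar]
  ring

/-! #### `Ĝ_N`, `χ̂_N` and the identities (4.6), (4.8)–(4.9) -/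

/-- **`Ĝ_N(m²,g₀,ν₀,z₀) = E_C(e^{-V₀(Λ)} φ̄_aφ_b)`**, `C = (-Δ+m²)⁻¹`.
[cite: BauerschmidtBrydgesSlade2015LogCorr, §4.1, eq. (4.7)] -/
def GhatN (d n : ℕ) [NeZero n] (m2 g₀ ν₀ z₀ : ℝ) (a b : TorusSite d n) : ℂ :=
  superExpectation (freeCovariance d n m2) (boltzmannZ0 g₀ ν₀ z₀ * ofFun fun φ => conj (φ a) * φ b)

/-- **`χ̂_N(m²,g₀,ν₀,z₀) = Σ_{x∈Λ} E_C(e^{-V₀(Λ)} φ̄_0φ_x)`**. [cite: BauerschmidtBrydgesSlade2015LogCorr, §4.1, eq. (4.8)] -/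
def chiHatNForm (d n : ℕ) [NeZero n] (m2 g₀ ν₀ z₀ : ℝ) : ℂ := ∑ x, GhatN d n m2 g₀ ν₀ z₀ 0 x

/-- `Ĝ_N` as a form side of `WeaklySAWSupersymmetricRepresentationAnalytic.lean`:
`Ĝ_N = ∫ e^{-S_{(1+z₀)(-Δ)}} e^{-Σ(g₀τ²+(ν₀+m²)τ)} φ̄_aφ_b`
(`e^{-S_{-Δ+m²}}e^{-z₀S_{-Δ}}e^{-Σ(g₀τ²+ν₀τ)} = e^{-S_{(1+z₀)(-Δ)}}e^{-Σ(g₀τ²+(ν₀+m²)τ)}`). [folklore] -/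
theorem GhatN_eq_formSide {m2 : ℝ} (hm : 0 < m2) (g₀ ν₀ z₀ : ℝ) (a b : TorusSite d n) :
    GhatN d n m2 g₀ ν₀ z₀ a b = superIntegral (ofFun (fun φ => φ b * conj (φ a)) *
      (superGauss ((((1 + z₀ : ℝ)) : ℂ) • negLaplacianC d n) * interactionForm g₀ (ν₀ + m2))) := by
  rw [GhatN, superExpectation, freeCovariance_inv hm, boltzmannZ0, massLaplacianC, ← mul_assoc, ← mul_assoc,
    superGauss_mul_superGauss,
    show negLaplacianC d n + Matrix.diagonal (fun _ => (m2 : ℂ)) + (z₀ : ℂ) • negLaplacianC d n =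
      (((1 + z₀ : ℝ)) : ℂ) • negLaplacianC d n + Matrix.diagonal (fun _ => (m2 : ℂ)) by
        push_cast; rw [add_smul, one_smul]; abel,
    superGauss_add_diagonal_mul_interactionForm,
    show (fun φ : TorusSite d n → ℂ => conj (φ a) * φ b) = fun φ => φ b * conj (φ a) from
      funext fun _ => mul_comm _ _]
  exact congrArg superIntegral (ofFun_comm _ _).symm

/-- **BBS 2015, eq. (4.6): `G_N(g,ν) = (1+z₀) Ĝ_N(m²,g₀,ν₀,z₀)`** with `g = g₀/(1+z₀)²`,
`ν = (ν₀+m²)/(1+z₀)` ((4.4)), for `m² > 0`, `g₀ > 0`, `ν₀ ∈ ℝ`, `z₀ > -1`, at the sites `(0,b)` — i.e.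
`∫ e^{-Σ_x(τ_{Δ,x}+gτ_x²+ντ_x)} φ̄_0φ_b = (1+z₀) E_C(e^{-V₀(Λ)} φ̄_0φ_b)`, `C = (-Δ+m²)⁻¹` (Proposition 3.1
and (ExF) with `F = φ̄_0φ_b`). [cite: BauerschmidtBrydgesSlade2015LogCorr, §4.1, eqs. (4.4), (4.6)–(4.7)] -/
theorem torusTwoPoint_eq_GhatN {m2 g₀ : ℝ} (hm : 0 < m2) (hg₀ : 0 < g₀) (ν₀ : ℝ) {z₀ : ℝ} (hz : -1 < z₀)
    (b : TorusSite d n) :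
    ((((torusTwoPoint d n (g₀ / (1 + z₀) ^ 2) ((ν₀ + m2) / (1 + z₀)) b).toReal : ℝ)) : ℂ) =
      (((1 + z₀ : ℝ)) : ℂ) * GhatN d n m2 g₀ ν₀ z₀ 0 b := by
  have hs : 0 < 1 + z₀ := by linarith
  have hs0 : 1 + z₀ ≠ 0 := hs.ne'
  have hg : 0 < g₀ / (1 + z₀) ^ 2 := by positivity
  have h1 : (1 + z₀) ^ 2 * (g₀ / (1 + z₀) ^ 2) = g₀ := by field_simp
  have h2 : (((1 + z₀ : ℝ)) : ℂ) * ((((ν₀ + m2) / (1 + z₀) : ℝ)) : ℂ) = (((ν₀ + m2 : ℝ)) : ℂ) := by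
    have : (((1 + z₀ : ℝ)) : ℂ) ≠ 0 := by exact_mod_cast hs0
    rw [← Complex.ofReal_mul]
    congr 1
    field_simp
  rw [torusTwoPoint_toReal_eq_torusTwoPointC hg _ b, torusTwoPointC_eq_formSideC hg b,
    formSideC_scale re_quadForm_negLaplacianC_nonneg hg hs 0 b, h1, h2, GhatN_eq_formSide hm, ← formSideC_ofReal]

/-- **BBS 2015, eq. (4.9): `χ_N(g,ν) = (1+z₀) χ̂_N(m²,g₀,ν₀,z₀)`**, `χ̂_N = Σ_x E_C(e^{-V₀(Λ)}φ̄_0φ_x)`,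
with `g = g₀/(1+z₀)²`, `ν = (ν₀+m²)/(1+z₀)`, for `m² > 0`, `g₀ > 0`, `ν₀ ∈ ℝ`, `z₀ > -1`.
[cite: BauerschmidtBrydgesSlade2015LogCorr, §4.1, eqs. (4.8)–(4.9)] -/
theorem torusSusceptibility_eq_chiHatNForm {m2 g₀ : ℝ} (hm : 0 < m2) (hg₀ : 0 < g₀) (ν₀ : ℝ) {z₀ : ℝ}
    (hz : -1 < z₀) :
    ((((torusSusceptibility d n (g₀ / (1 + z₀) ^ 2) ((ν₀ + m2) / (1 + z₀))).toReal : ℝ)) : ℂ) =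
      (((1 + z₀ : ℝ)) : ℂ) * chiHatNForm d n m2 g₀ ν₀ z₀ := by
  have hs : 0 < 1 + z₀ := by linarith
  have hg : 0 < g₀ / (1 + z₀) ^ 2 := by positivity
  rw [torusSusceptibility_eq_sum_torusTwoPoint n _ _, ENNReal.toReal_sum fun b _ => ?_, Complex.ofReal_sum,
    chiHatNForm, Finset.mul_sum]
  · exact Finset.sum_congr rfl fun b _ => torusTwoPoint_eq_GhatN hm hg₀ ν₀ hz b
  · have h := torusSusceptibility_lt_top (d := d) n hg ((ν₀ + m2) / (1 + z₀))
    rw [torusSusceptibility_eq_sum_torusTwoPoint n _ _] at h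
    exact (lt_of_le_of_lt (Finset.single_le_sum (fun i _ => (bot_le : (0 : ℝ≥0∞) ≤ _)) (Finset.mem_univ b)) h).ne

/-- **The reparametrised susceptibility IS the super-expectation (4.8)**: the real number
`chiHatN d n m² g₀ ν₀ z₀` of `WeaklySAWFiniteVolumeRenormalised.lean` (defined through (4.9) as
`χ_N(g,ν)/(1+z₀)`) equals `Σ_x E_C(e^{-V₀(Λ)}φ̄_0φ_x)` (`m² > 0`, `g₀ > 0`, `z₀ > -1`).
[cite: BauerschmidtBrydgesSlade2015LogCorr, §4.1, eqs. (4.8)–(4.9)] -/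
theorem chiHatN_eq_chiHatNForm {m2 g₀ : ℝ} (hm : 0 < m2) (hg₀ : 0 < g₀) (ν₀ : ℝ) {z₀ : ℝ} (hz : -1 < z₀) :
    ((chiHatN d n m2 g₀ ν₀ z₀ : ℝ) : ℂ) = chiHatNForm d n m2 g₀ ν₀ z₀ := by
  have hs : (((1 + z₀ : ℝ)) : ℂ) ≠ 0 := by
    have : (1 + z₀ : ℝ) ≠ 0 := by linarith
    exact_mod_cast this
  have h := torusSusceptibility_eq_chiHatNForm (d := d) (n := n) hm hg₀ ν₀ hz
  rw [← one_add_mul_chiHatN d n m2 g₀ ν₀ hz, Complex.ofReal_mul] at h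
  exact mul_left_cancel₀ hs h

/-- **The remark closing §3.4**: for every `ε > 0` (and `g > 0`, `ν ∈ ℝ`),
`∫ e^{-Σ_x(τ_{Δ,x}+gτ_x²+ντ_x)} φ̄_0φ_b = E_C(e^{-Σ_x(gτ_x²+(ν-ε)τ_x)} φ̄_0φ_b)` with the positive-definite
covariance `C = (-Δ+ε)⁻¹` (the case `z₀ = 0`, `m² = ε` of (4.6)). [cite: BauerschmidtBrydgesSlade2015LogCorr, §3.4 (last display: "for any ε > 0, (3.12) can be written as E_C(e^{-Σ(gτ²+(ν-ε)τ)}φ̄_aφ_b) with C = (-Δ+ε)⁻¹")] -/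
theorem torusTwoPoint_eq_superExpectation {ε g : ℝ} (hε : 0 < ε) (hg : 0 < g) (ν : ℝ) (b : TorusSite d n) :
    ((((torusTwoPoint d n g ν b).toReal : ℝ)) : ℂ) =
      superExpectation (freeCovariance d n ε) (interactionForm g (ν - ε) * ofFun fun φ => conj (φ 0) * φ b) := by
  have h := torusTwoPoint_eq_GhatN (d := d) (n := n) hε hg (ν - ε) (show (-1 : ℝ) < 0 by norm_num) b
  simp only [add_zero, one_pow, div_one, sub_add_cancel, Complex.ofReal_one, one_mul] at h
  rw [h, GhatN, boltzmannZ0, Complex.ofReal_zero, zero_smul, superGauss_zero, one_mul]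

end Torus

end CTWSAW

end Literature.Barriers.CriticalPhenomena
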